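import Mathlib.Analysis.SpecificLimits.Normed

/-! # CRIT-1 g6 — kernel shadow for the cross-read (T-h) §1 SCALE-SHIFT claim (toy factor, not Bałaban's β)

Context: `Cruxes/EndpointGivenBR13SepCoPH/CRIT-1-CROSSREAD-E-CRIT2-2-geometric-letters.md` §1 (CRIT-1 g6, concurring with CRIT-2 g3's E-CRIT2-2):
modulo H_FE′ (`FirstEntryOnly`) and the transport identification `F_k(g₀) ≈ β^{pr}(g_k^{run}(g₀))`, `1∕g_k² = 1∕g₀² + c k`, the letter
`T4CouplingMatching.ScaleShiftRate c ρ γ β` (`|β (k+1) w − β k (Fin.tail w)| ≤ c ρ^k` on the box) compares `F_{k+1}(w 0)` with `F_k(w 1)` at INDEPENDENT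
box points, hence needs the oscillation `osc_{]0,γ]} F_k ≍ |β₁| · γ²∕(1 + c k γ²)` to be `O(ρ^k)`.  The toy below is the exact elementary fact behind
«≍ 1∕k beats every geometric rate»: the one-loop factor `γ²∕(1 + c k γ²)` (`c ≥ 0`, `γ > 0`) admits NO bound `≤ C ρ^k` with `0 ≤ ρ < 1`.
Companion of idea-5 Sketch5's `marginalTransport_not_geomFading` (the MODULUS factor); this one is the SHIFT∕oscillation factor.
Honest scope: a real-analysis toy; nothing of Bałaban asserted; no record β named; K1⁸ stmt-QuantumFields-26907 untouched; Clay NOT proved. -/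

open Filter Topology

namespace Summit.QuantumFields.YangMills.Cruxes.EndpointGivenBR13SepCoPH.Crit1ShiftOscToy

/-- **The one-loop oscillation factor has no geometric bound in the scale.**  For `c ≥ 0`, `γ > 0` there are no `C`, `ρ ∈ [0,1[` with
`γ² ∕ (1 + c·k·γ²) ≤ C·ρ^k` for all `k` : the left side is `≥ γ²∕(1 + cγ²) · 1∕(k+1)`-type (polynomial) while `(1 + c k γ²)·C ρ^k → 0`. [folklore] -/
theorem shiftOsc_not_geom {c γ : ℝ} (hc : 0 ≤ c) (hγ : 0 < γ) :
    ¬ ∃ C ρ : ℝ, 0 ≤ ρ ∧ ρ < 1 ∧ ∀ k : ℕ, γ ^ 2 / (1 + c * k * γ ^ 2) ≤ C * ρ ^ k := by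
  rintro ⟨C, ρ, hρ0, hρ1, h⟩
  have hγ2 : 0 < γ ^ 2 := by positivity
  -- (1 + c k γ²) · C ρ^k → 0
  have hρabs : |ρ| < 1 := by rwa [abs_of_nonneg hρ0]
  have t1 : Tendsto (fun k : ℕ => C * ρ ^ k) atTop (𝓝 0) := by
    simpa using (tendsto_pow_atTop_nhds_zero_of_lt_one hρ0 hρ1).const_mul C
  have t2 : Tendsto (fun k : ℕ => (k : ℝ) ^ 1 * ρ ^ k) atTop (𝓝 0) :=
    tendsto_pow_const_mul_const_pow_of_abs_lt_one 1 hρabs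
  have t3 : Tendsto (fun k : ℕ => (1 + c * k * γ ^ 2) * (C * ρ ^ k)) atTop (𝓝 0) := by
    have e : (fun k : ℕ => (1 + c * k * γ ^ 2) * (C * ρ ^ k))
        = fun k : ℕ => C * ρ ^ k + (c * γ ^ 2 * C) * ((k : ℝ) ^ 1 * ρ ^ k) := by
      funext k; ring
    rw [e]
    simpa using t1.add (t2.const_mul (c * γ ^ 2 * C))
  -- eventually (1 + c k γ²) · C ρ^k < γ², contradicting the bound
  obtain ⟨k, hk⟩ := (t3.eventually (gt_mem_nhds hγ2)).exists
  have hden : 0 < 1 + c * k * γ ^ 2 := by positivity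
  have hle : γ ^ 2 ≤ (1 + c * k * γ ^ 2) * (C * ρ ^ k) := by
    have := h k
    rwa [div_le_iff₀ hden, mul_comm] at this
  exact absurd (hle.trans_lt hk) (lt_irrefl _)

/-- … hence, a fortiori, no bound `≤ c' ρ^k` for the oscillation `|β₁| · γ²∕(1 + c k γ²)` when `β₁ ≠ 0` (divide by `|β₁|`). [folklore] -/
theorem shiftOsc_not_geom_of_ne_zero {c γ β₁ : ℝ} (hc : 0 ≤ c) (hγ : 0 < γ) (hβ : β₁ ≠ 0) :
    ¬ ∃ C ρ : ℝ, 0 ≤ ρ ∧ ρ < 1 ∧ ∀ k : ℕ, |β₁| * (γ ^ 2 / (1 + c * k * γ ^ 2)) ≤ C * ρ ^ k := by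
  rintro ⟨C, ρ, hρ0, hρ1, h⟩
  have hb : 0 < |β₁| := abs_pos.mpr hβ
  refine shiftOsc_not_geom hc hγ ⟨C / |β₁|, ρ, hρ0, hρ1, fun k => ?_⟩
  rw [div_mul_eq_mul_div, le_div_iff₀ hb, mul_comm]
  exact h k

end Summit.QuantumFields.YangMills.Cruxes.EndpointGivenBR13SepCoPH.Crit1ShiftOscToy
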